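import Summits.FinalStateConjecture.FinalStateConjecture.Theses.StarvedNecks
import Summits.FinalStateConjecture.FinalStateConjecture.Theses.TangentConeAtIPlus
import HarnessLib

/-!
# Route StarvedNecks — the generic import `HonestFixedRadiusSettlingT` (item stmt-FinalStateConjecture-17575)
# follows from its RAYS-LESS core plus the route's own ∀-items and `TangentConeAtIPlus.SettledExteriorHoldsRays`

Support file of item stmt-FinalStateConjecture-17575 (line lead, line `Sketch`, 2026-08-17; the lever of crux idea
card `rays-see-only-o`, `Cruxes/HonestFixedRadiusSettlingT/Ideas/rays-see-only-o.md`).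

T = `Theses.StarvedNecks.HonestFixedRadiusSettlingT` asserts, TAME-Christodoulou-generically in
`admissibleVacuumData X` for every admissible `3`-manifold `X`, the property `P_T D`: "`D` has an MGHD, and every
MGHD `𝒟` has complete `𝓘⁺` and admits `(O, d, R₀)` — a `C⁴` `FinalStateDecomposition` `d` of
`O = exteriorOf 𝒟 d.charted` — with `RaysStayInClosure 𝒟 O`, HonestCore`(d, R₀)`, HonestFar`(d, R₀)` and pairwise
distinct asymptotic four-velocities".  The rays clause mentions `O` and nothing of `d`, and this route's
deterministic items REPLACE the decomposition while KEEPING `O`; so the clause can be paid after the seam: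

* `h₀` — the **rays-less core**: the body of T verbatim with the single conjunct
  `RaysStayInClosure 𝒟.toCauchyDevelopment O ∧` deleted (strictly weaker than T; written out in full because the
  tree has no name for it);
* `hS : Theses.StarvedNecks.NecksCertifyR` (item 17574; = `GapDecaySuffices` ∘ `NeckGapDecay` in route rev ≥ 6):
  a `C²` HonestCore ∧ SEAMED decomposition `d₂` of the SAME `O`;
* `hE : Theses.StarvedNecks.SeamedChartsExhaust` (item 13551, proved: `WideAnchoring.seamedChartsExhaust`):
  `HasExhaustiveCharts d₂`;
* `hF : Theses.StarvedNecks.FutureOrientedOfSeamed` (item 17576, proved: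
  `ClockDualityRays.FutureOrientedOfSeamed_of`): `IsFutureOriented d₂`;
* `hR : Theses.TangentConeAtIPlus.SettledExteriorHoldsRays` (item 17673): complete `𝓘⁺` + such a `d₂` ⇒
  `RaysStayInClosure 𝒟 O`;

and then the ORIGINAL `C⁴` witness `(O, d, R₀)` of the core serves T with the clause filled in; tame genericity is
antitone in the exceptional set (`mono`, verbatim the first step of the route's `closes`).  The conclusion is the
route decl BY NAME.  Consequence for the planner: T ⇐ (rays-less core) + 17574 + 13551 + 17576 + 17673 — the rays
conjunct carries no obligation of its own inside the generic import (and the refuter's liability L2 / BN-4-4 on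
exotic `X` bears on 17673 and on the summit's clause (C), not on this route's core).

References: Christodoulou, CQG 16 (1999) A23, p. A24 (genericity by positive codimension in a fixed space of data);
Dafermos–Luk, arXiv:1710.01722, Conjecture 1 (the exterior region); lead c8's `StarvedNecksHonestFixedRadiusSettlingOfT`
(same `mono` shape).
-/

-- the doubled `FinalStateConjecture` path component is the summit/problem naming scheme, not a mistake
set_option linter.dupNamespace false

noncomputable section

namespace Summit.FinalStateConjecture.FinalStateConjecture.Theorems.StarvedNecks.Rayless

open scoped Manifold ContDiff ENNReal Topology
open Filter Set Literature.Geometry.Lorentzian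

/-- Tame Christodoulou genericity of `P` (codimension `1`) implies tame Christodoulou genericity of every
pointwise-weaker property `Q` on the admissible class (the exceptional set shrinks; the same end and the same
witness curve through a `Q`-exceptional datum, which is `P`-exceptional, serve). Christodoulou, CQG 16 (1999) A23,
p. A24. [folklore] -/
private theorem isTameChristodoulouGeneric_of_imp {X : Type} [TopologicalSpace X] [ChartedSpace E3 X]
    [IsManifold (𝓡 3) ∞ X] {𝓓 : Set (InitialDataSet (𝓡 3) X)} {P Q : InitialDataSet (𝓡 3) X → Prop}
    (hPQ : ∀ D ∈ 𝓓, P D → Q D) (hP : InitialDataSet.IsTameChristodoulouGeneric 𝓓 P 1) :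
    InitialDataSet.IsTameChristodoulouGeneric 𝓓 Q 1 := by
  intro d hd
  obtain ⟨e, F, hF, himm, h0, hinj, hmem, hE⟩ := hP d ⟨hd.1, fun h ↦ hd.2 (hPQ d hd.1 h)⟩
  exact ⟨e, F, hF, himm, h0, hinj, hmem, fun c hc hc' ↦ hE c hc ⟨hc'.1, fun h ↦ hc'.2 (hPQ _ hc'.1 h)⟩⟩

/-- **T from its rays-less core: `Theses.StarvedNecks.HonestFixedRadiusSettlingT` (item stmt-FinalStateConjecture-17575)
follows from the same statement WITHOUT the `RaysStayInClosure` conjunct, given `NecksCertifyR` (17574),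
`SeamedChartsExhaust` (13551, proved), `FutureOrientedOfSeamed` (17576, proved) and
`TangentConeAtIPlus.SettledExteriorHoldsRays` (17673).**  Hypothesis `h₀` is the body of T verbatim with the one
conjunct `RaysStayInClosure 𝒟.toCauchyDevelopment O ∧` deleted: for every admissible `3`-manifold `X`,
tame-Christodoulou-generically in `admissibleVacuumData X`, the datum has an MGHD and every MGHD `𝒟` has complete
`𝓘⁺` and admits `(O, d, R₀)`, a `C⁴` `FinalStateDecomposition` `d` of `O = exteriorOf 𝒟 d.charted` with
HonestCore`(d, R₀)`, HonestFar`(d, R₀)` and pairwise distinct asymptotic four-velocities.  Proof: genericity is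
antitone in the exceptional set (`isTameChristodoulouGeneric_of_imp`); pointwise, S re-seams the core's witness into
a `C²` HonestCore ∧ SEAMED decomposition `d₂` of the same `O`, E and F make it exhaustive and future-oriented,
17673 returns `RaysStayInClosure 𝒟 O` (sub-extremality of `d₂` = HonestCore (a).1), and the original `C⁴`
witness `(O, d, R₀)` is re-used. Christodoulou, CQG 16 (1999) A23, p. A24; Dafermos–Luk arXiv:1710.01722,
Conjecture 1. [folklore] -/
theorem honestFixedRadiusSettlingT_of_rayless : (open Literature.Geometry.Lorentzian in open scoped ContDiff ENNReal in let Hc := ( fun (𝓢 : Spacetime.{0} 4) (O : Set 𝓢.carrier) (k : ℕ) (d : FinalStateDecomposition 𝓢 O k) (R₀ : ℝ) => let B := d.background; let t := fun i ↦ (B i).time; let r := fun i ↦ (B i).radius; let Ψ := d.chart; (∀ i, Kerr.IsSubextremal (d.mass i) (d.spin i) ∧ 100 * d.mass i ≤ R₀ ∧ 0 < ((d.motion i).1 : E4 ≃L[ℝ] E4) (E4.basisVector 0) 0) ∧ (∀ i (ϱ τ₂ : ℝ), R₀ ≤ ϱ → d.τ₀ < τ₂ → Ψ i '' {x | d.τ₀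 < t i x.1 ∧ t i x.1 < τ₂ ∧ r i x.1 < ϱ} ⊆ 𝓢.metric.causalPast 𝓢.timeOrientation (Ψ i '' (B i).truncTimeSlab ϱ τ₂)) ∧ (∀ i (τ' : ℝ) (ϱ : ℝ → ℝ), Continuous ϱ → d.τ₀ < τ' → let A := Ψ i '' {x | τ' ≤ t i x.1 ∧ r i x.1 ≤ ϱ (t i x.1)}; closure A ∩ O ⊆ A) ∧ (∀ y : d.flatDomain, d.τ₀ < y.1 0 → 𝓢.timeOrientation.IsFutureDirected (mfderiv 𝓘(ℝ, E4) (𝓡 4) d.flatChart y (E4.basisVector 0))) ); let Hf := ( fun (𝓢 : Spacetime.{0} 4) (O : Set 𝓢.carrier) (k : ℕ) (d : FinalStateDecomposition 𝓢 O k) (R₀ : ℝ) => let B := d.background; let t := fun i ↦ (B i).time; let r := fun i ↦ (B i).radius; let Φ := d.flatChart; (∀ τ₂ : ℝ, d.τ₀ < τ₂ → Φ '' {y | d.τ₀ < y.1 0 ∧ y.1 0 < τ₂} ⊆ 𝓢.metric.causalPast 𝓢.timeOrientation (Φ '' (Minkowski.backgroundOn d.flatDomain).timeSlab τ₂)) ∧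 (∀ τ' : ℝ, d.τ₀ < τ' → closure (Φ '' {y | τ' ≤ y.1 0 ∧ ∀ i, d.excision i (y.1 0) + 1 ≤ r i y.1}) ⊆ Φ '' {y | τ' ≤ y.1 0}) ∧ (∀ i, ∃ T : ℝ, supCkENorm (Subtype.val '' {x : (B i).domain | T ≤ t i x.1 ∧ R₀ ≤ r i x.1 ∧ ∀ j, j ≠ i → r i x.1 ≤ r j x.1}) 0 (𝓢.deviationExtend (B i) (d.chart i)) ≤ ENNReal.ofReal (1 / (10 * ‖(((d.motion i).1 : E4 ≃L[ℝ] E4) : E4 →L[ℝ] E4)‖ ^ 2))) ); ∀ (X : Type) [TopologicalSpace X] [ChartedSpace E3 X] [IsManifold (𝓡 3) ∞ X] [T2Space X] [SecondCountableTopology X] [ConnectedSpace X], InitialDataSet.IsTameChristodoulouGeneric (admissibleVacuumData X) (fun D ↦ (∃ 𝒟 : VacuumCauchyDevelopment D, 𝒟.IsMaximal) ∧ ∀ 𝒟 : VacuumCauchyDevelopment D, 𝒟.IsMaximal → HasCompleteNullInfinity 𝒟.toCauchyDevelopment ∧ ∃ (O : Set 𝒟.carrier) (d : FinalStateDecomposition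 𝒟.toSpacetime O 4) (R₀ : ℝ), O = exteriorOf 𝒟.toCauchyDevelopment d.charted ∧ Hc 𝒟.toSpacetime O 4 d R₀ ∧ Hf 𝒟.toSpacetime O 4 d R₀ ∧ (∀ i j : Fin d.N, i ≠ j → ((d.motion i).1 : E4 ≃L[ℝ] E4) (E4.basisVector 0) ≠ ((d.motion j).1 : E4 ≃L[ℝ] E4) (E4.basisVector 0))) 1) → Theses.StarvedNecks.NecksCertifyR → Theses.StarvedNecks.SeamedChartsExhaust → Theses.StarvedNecks.FutureOrientedOfSeamed → Theses.TangentConeAtIPlus.SettledExteriorHoldsRays → Theses.StarvedNecks.HonestFixedRadiusSettlingT := by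
  intro h₀ hS hE hF hR X _ _ _ _ _ _
  refine isTameChristodoulouGeneric_of_imp ?_ (h₀ X)
  rintro D hD ⟨hex, hall⟩
  refine ⟨hex, fun 𝒟 h𝒟 ↦ ?_⟩
  obtain ⟨hscri, O, d, R₀, hO, hcore, hfar, hdv⟩ := hall 𝒟 h𝒟
  -- S: re-seam into a C² HonestCore ∧ SEAMED decomposition d₂ of the same O
  obtain ⟨d₂, R, R₀', hO₂, hcore₂, hseam⟩ := hS X D hD 𝒟 h𝒟 O d R₀ hO hcore hfar hdv
  -- E, F decorate d₂; 17673 returns the rays clause for this O; re-use the original C⁴ witness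
  exact ⟨hscri, O, d, R₀, hO,
    hR X D hD 𝒟 h𝒟 hscri O d₂ (fun i ↦ (hcore₂.1 i).1) hO₂
      (hE X D hD 𝒟 h𝒟 O d₂ R R₀' hO₂ hcore₂ hseam) (hF X D hD 𝒟 h𝒟 O d₂ R R₀' hO₂ hcore₂ hseam),
    hcore, hfar, hdv⟩

end Summit.FinalStateConjecture.FinalStateConjecture.Theorems.StarvedNecks.Rayless

end
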